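/-
[OURS · L1 W4.5(b) · EL♮(3)] SPECIMEN-TC⁺ (quartic, one inner step (i)) — the chart centred at the inner point after the first point step.
-/
import Summits.ResolutionOfSingularities.ResolutionOfSingularities.Theorems.EquisingularLiftEquisingularLiftNatSpecimenQuarticTcDeltaChartStep
import Summits.ResolutionOfSingularities.ResolutionOfSingularities.Theorems.EquisingularLiftEquisingularLiftNatSpecimenQuarticTcDeltaTransport
import Mathlib.AlgebraicGeometry.Morphisms.FiniteType
import HarnessLib

/-!
# [OURS · L1 W4.5(b) · EL♮(3)] SPECIMEN-TC⁺ for the quartic — part ST: the CHART `w₁ : Spec k[X] → Y′` CENTRED AT THE INNER POINT after the first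
# point step, with `𝓘_{T₂} · 𝒪 = (gL)~`, `𝓘_{Z₁} · 𝒪 = (X₁, X₂)~`
# (crux `EquisingularLiftNatThree` = stmt-ResolutionOfSingularities-20148; res-L1-w45b-lead-2 DEALS (D2) 2026-08-27T11:55:26Z «NON-VACUITY
# CERTIFICATES TC⁺»; scoping memo D/res-D-pv-034/SPECIMEN-TCPLUS-SCOPE.md §5 «COORDINATES»; helper, closes nothing)

HONEST FRAMING. OURS (cell `res-hironaka`, chain w45b, slot W4.5(b)); NOT a statement of any manuscript; AI-written, weaker than expert review.

Setting of `…TcDeltaChartStep`: a chart `u : Spec k[X] → Y` with `𝓘_{x₀} · 𝒪 = 𝔪₀~`, `𝓘_T · 𝒪 = (z² + x⁴ + y⁴)~`, and ANY blow-up `b : Y′ → Y` at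
`x₀`. On the `x`-chart `c₀ : Spec k[X][𝔪/X₀] → Y′` of `b` the strict transform `T₂` is `V(f′₀)`, `f′₀ = (z/x)² + x²(1 + (y/x)⁴)`, and the carrier
`Z₁ = b⁻¹{x₀} ∩ T₂` is `V(x, f′₀)` with radical `(x, z/x)`. Re-coordinatising by `ψ : k[X₀,X₁,X₂] ≅ k[X][𝔪/X₀]`, `X₀ ↦ y/x`, `X₁ ↦ x`, `X₂ ↦ z/x`
(stub-4's `exists_ringEquiv_pointChart` after `X₀ ↔ X₁`) gives the chart `w₁ = Spec(ψ⁻¹) ≫ c₀` CENTRED AT THE INNER POINT `y₁ = w₁(o)` with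
`𝓘_{T₂} · 𝒪 = (gL)~`, `gL = X₂² + X₁²(1 + X₀⁴)` (`…TcDeltaLocalCharts.gL`), and `𝓘_{Z₁} · 𝒪 = (X₁, X₂)~` (`exists_innerChart`); `y₁ ∈ Z₁`.
Also: closed points of charts in Jacobson schemes, and blow-ups of Jacobson schemes are Jacobson.

References: Stacks 0804, 080E; Hartshorne II Ex. 3.2.6 (via the cited tree files).
-/

set_option linter.dupNamespace false -- mandated namespace `Summit.<Summit>.<Problem>` of this single-conjunct summit

noncomputable section

open CategoryTheory CategoryTheory.Limits AlgebraicGeometry TopologicalSpace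
open MvPolynomial
open AlgebraicGeometry.Scheme.IdealSheafData
open Literature.AlgebraicGeometry.Resolution
open Summit.ResolutionOfSingularities.ResolutionOfSingularities.Theorems.EquisingularLift

namespace Summit.ResolutionOfSingularities.ResolutionOfSingularities.Cruxes.EquisingularLiftNat.Sections

namespace SpecimenQuarticTcPlus

open SpecimenQuarticTcDelta

/-! ## Closed points of charts in Jacobson schemes -/

section Jacobson

variable {k : Type} [Field k]

/-- The image of the origin under an open-immersion chart into a Jacobson scheme is a closed point. [folklore] -/
theorem isClosed_singleton_chart_of_jacobson {F : Scheme.{0}} [JacobsonSpace F]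
    (w : Spec (CommRingCat.of (MvPolynomial (Fin 3) k)) ⟶ F) [IsOpenImmersion w] : IsClosed ({w (o k)} : Set F) := by
  have h := w.isOpenEmbedding.preimage_closedPoints (Y := F)
  have ho : o k ∈ w ⁻¹' closedPoints F := by
    rw [h]; exact isClosed_singleton_o k
  exact ho

/-- A blow-up of a Jacobson scheme is Jacobson (blow-ups are locally of finite type). [folklore] -/
theorem jacobsonSpace_of_isBlowup {F F' : Scheme.{0}} [JacobsonSpace F] [IsLocallyNoetherian F] {b : F' ⟶ F} {C : F.IdealSheafData} (hb : IsBlowup b C) :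
    JacobsonSpace F' := by
  haveI : IsProper b := hb.isProper
  exact LocallyOfFiniteType.jacobsonSpace b

end Jacobson

/-! ## The chart centred at the inner point -/

section InnerStage

variable {k : Type} [Field k] [IsAlgClosed k]
variable {Y : Scheme.{0}} (u : Spec (CommRingCat.of (MvPolynomial (Fin 3) k)) ⟶ Y) [IsOpenImmersion u]
variable {x₀ : Y} (hx₀ : IsClosed ({x₀} : Set Y))
variable (hux : (vanishingIdeal (⟨{x₀}, hx₀⟩ : Closeds Y)).comap u =
    ofIdealTop ((PointBlowup.originIdeal 2 k).map (Scheme.ΓSpecIso (CommRingCat.of (MvPolynomial (Fin 3) k))).inv.hom))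
variable {T : Set Y} (hTc : IsClosed T)
variable (huT : (vanishingIdeal (⟨T, hTc⟩ : Closeds Y)).comap u =
    ofIdealTop ((Ideal.span {(X 2 ^ 2 + X 0 ^ 4 + X 1 ^ 4 : MvPolynomial (Fin 3) k)}).map
      (Scheme.ΓSpecIso (CommRingCat.of (MvPolynomial (Fin 3) k))).inv.hom))
variable {Y' : Scheme.{0}} {b : Y' ⟶ Y}

/-- `Spec` of a ring isomorphism is an isomorphism. [folklore] -/
theorem isIso_specMap_of_ringEquiv {A B : Type} [CommRing A] [CommRing B] (ψ : A ≃+* B) :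
    IsIso (Spec.map (CommRingCat.ofHom ψ.symm.toRingHom)) := by
  change IsIso (Scheme.Spec.mapIso ψ.toCommRingCatIso.op).inv
  infer_instance

/-- `(gL)` is a radical ideal (`gL` is prime, `k = k̄`, `char k ≠ 2`). [folklore] -/
theorem radical_span_gL (h2 : (2 : k) ≠ 0) : (Ideal.span {gL k}).radical = Ideal.span {gL k} := by
  have hp : Prime (gL k) := by
    have e : gL k = X 2 ^ 2 + X 1 ^ 2 * (X 0 ^ 4 + 1) := by simp only [gL]; ring
    rw [e]; exact prime_model₁ k h2
  exact ((Ideal.span_singleton_prime hp.ne_zero).mpr hp).radical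

include hux huT in
/-- **The chart centred at the inner point.** For any blow-up `b : Y′ → Y` at `x₀` there is an open-immersion chart `w₁ : Spec k[X] → Y′` with
`𝓘_{T₂} · 𝒪 = (gL)~` (`T₂ = closure b⁻¹(T ∖ {x₀})`), `𝓘_{Z₁} · 𝒪 = (X₁, X₂)~` (`Z₁ = b⁻¹{x₀} ∩ T₂`) and `w₁(o) ∈ Z₁`.
[OURS · SPECIMEN-TC⁺ (i) coordinates] [cite: StacksProject, Tag 0804] -/
theorem exists_innerChart (h2 : (2 : k) ≠ 0) (hb : IsBlowup b (vanishingIdeal (⟨{x₀}, hx₀⟩ : Closeds Y))) :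
    ∃ (w₁ : Spec (CommRingCat.of (MvPolynomial (Fin 3) k)) ⟶ Y') (_ : IsOpenImmersion w₁),
      (vanishingIdeal (⟨closure (b ⁻¹' (T \ {x₀})), isClosed_closure⟩ : Closeds Y')).comap w₁ =
        ofIdealTop ((Ideal.span {gL k}).map (Scheme.ΓSpecIso (CommRingCat.of (MvPolynomial (Fin 3) k))).inv.hom) ∧
      (vanishingIdeal (⟨b ⁻¹' {x₀} ∩ closure (b ⁻¹' (T \ {x₀})), isClosed_inter hx₀ b⟩ : Closeds Y')).comap w₁ =
        ofIdealTop ((Ideal.span (Set.range (WhitneyCubic.cen k))).map (Scheme.ΓSpecIso (CommRingCat.of (MvPolynomial (Fin 3) k))).inv.hom) ∧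
      w₁ (o k) ∈ b ⁻¹' {x₀} ∩ closure (b ⁻¹' (T \ {x₀})) := by
  have hI := hI_chart u hx₀ hux
  have hT := hT_chart u hTc huT
  obtain ⟨c₀, hc₀oi, -, hcb⟩ := exists_chartE (chartOpen u) (chartRingEquiv u) hx₀ hI hb 0
  -- the coordinates `ψ : k[X₀,X₁,X₂] ≅ k[X][𝔪/X₀]`, `X₀ ↦ y/x`, `X₁ ↦ x`, `X₂ ↦ z/x`
  obtain ⟨θ, hθ0, hθj⟩ := SpecimenQuartic.exists_ringEquiv_pointChart k 0
  set ψ : MvPolynomial (Fin 3) k ≃+* PointBlowup.Chart 2 k 0 := (renameEquiv k (Equiv.swap (0 : Fin 3) 1)).toRingEquiv.trans θ with hψ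
  have hψ0 : ψ (X 0) = PointBlowup.frac 2 k 0 1 := by
    simp [hψ, Equiv.swap_apply_left, hθj 1 (by decide)]
  have hψ1 : ψ (X 1) = PointBlowup.exc 2 k 0 := by
    simp [hψ, Equiv.swap_apply_right, hθ0]
  have hψ2 : ψ (X 2) = PointBlowup.frac 2 k 0 2 := by
    simp [hψ, Equiv.swap_apply_of_ne_of_ne, hθj 2 (by decide)]
  have hψg : ψ (gL k) = PointBlowup.frac 2 k 0 2 ^ 2 + PointBlowup.exc 2 k 0 ^ 2 * (1 + PointBlowup.frac 2 k 0 1 ^ 4) := by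
    rw [gL, map_add, map_pow, hψ2, map_mul, map_pow, hψ1, map_add, map_one, map_pow, hψ0]
  -- the chart
  haveI := isIso_specMap_of_ringEquiv ψ
  let w₁ : Spec (CommRingCat.of (MvPolynomial (Fin 3) k)) ⟶ Y' := Spec.map (CommRingCat.ofHom ψ.symm.toRingHom) ≫ c₀
  haveI : IsOpenImmersion w₁ := inferInstance
  -- preimages under `Spec ψ⁻¹`
  have hpre : ∀ s : Set (PointBlowup.Chart 2 k 0),
      (Spec.map (CommRingCat.ofHom ψ.symm.toRingHom)) ⁻¹' PrimeSpectrum.zeroLocus s = PrimeSpectrum.zeroLocus (ψ.symm '' s) := fun s => by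
    change PrimeSpectrum.comap ψ.symm.toRingHom ⁻¹' _ = _
    rw [PrimeSpectrum.preimage_comap_zeroLocus]
    rfl
  have hw₁pre : ∀ A : Set Y', w₁ ⁻¹' A = (Spec.map (CommRingCat.ofHom ψ.symm.toRingHom)) ⁻¹' (c₀ ⁻¹' A) := fun A => by
    change (Spec.map (CommRingCat.ofHom ψ.symm.toRingHom) ≫ c₀) ⁻¹' A = _
    rw [Scheme.Hom.comp_base, TopCat.coe_comp, Set.preimage_comp]
  -- `T₂` and `Z₁` on the chart `c₀`
  have hT₂ : c₀ ⁻¹' closure (b ⁻¹' (T \ {x₀})) =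
      PrimeSpectrum.zeroLocus {PointBlowup.frac 2 k 0 2 ^ 2 + PointBlowup.exc 2 k 0 ^ 2 * (1 + PointBlowup.frac 2 k 0 1 ^ 4)} :=
    preimage_strictTransform_eq hx₀ hI hT hcb (factor_chart₀ k) (prime_strict_chart₀ k h2) (not_strict_dvd_exc_chart₀ k)
  have hZ₁ : c₀ ⁻¹' (b ⁻¹' {x₀} ∩ closure (b ⁻¹' (T \ {x₀}))) =
      PrimeSpectrum.zeroLocus {PointBlowup.exc 2 k 0, PointBlowup.frac 2 k 0 2 ^ 2 + PointBlowup.exc 2 k 0 ^ 2 * (1 + PointBlowup.frac 2 k 0 1 ^ 4)} := by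
    rw [Set.preimage_inter, preimage_preimage_singleton hx₀ hI hcb, hT₂]
    exact (PrimeSpectrum.zeroLocus_union {PointBlowup.exc 2 k 0} _).symm.trans (by rw [Set.singleton_union])
  have hw₁T₂ : w₁ ⁻¹' closure (b ⁻¹' (T \ {x₀})) = PrimeSpectrum.zeroLocus {gL k} := by
    rw [hw₁pre, hT₂, hpre, Set.image_singleton, ← hψg, ψ.symm_apply_apply]
  have hw₁Z₁ : w₁ ⁻¹' (b ⁻¹' {x₀} ∩ closure (b ⁻¹' (T \ {x₀}))) =
      PrimeSpectrum.zeroLocus {(X 1 : MvPolynomial (Fin 3) k), X 2 ^ 2 + X 1 ^ 2 * (1 + X 0 ^ 4)} := by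
    rw [hw₁pre, hZ₁, hpre, Set.image_pair, ← hψg, ψ.symm_apply_apply, ← hψ1, ψ.symm_apply_apply]
  refine ⟨w₁, inferInstance, ?_, ?_, ?_⟩
  · rw [comap_vanishingIdeal_of_isOpenImmersion]
    have h : (Closeds.preimage (⟨closure (b ⁻¹' (T \ {x₀})), isClosed_closure⟩ : Closeds Y') w₁.continuous) =
        ⟨PrimeSpectrum.zeroLocus {gL k}, PrimeSpectrum.isClosed_zeroLocus _⟩ := Closeds.ext hw₁T₂
    rw [h, vanishingIdeal_zeroLocus_Spec, radical_span_gL h2]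
  · rw [comap_vanishingIdeal_of_isOpenImmersion]
    have h : (Closeds.preimage (⟨b ⁻¹' {x₀} ∩ closure (b ⁻¹' (T \ {x₀})), isClosed_inter hx₀ b⟩ : Closeds Y') w₁.continuous) =
        ⟨PrimeSpectrum.zeroLocus {(X 1 : MvPolynomial (Fin 3) k), X 2 ^ 2 + X 1 ^ 2 * (1 + X 0 ^ 4)}, PrimeSpectrum.isClosed_zeroLocus _⟩ :=
      Closeds.ext hw₁Z₁
    rw [h, vanishingIdeal_zeroLocus_Spec, SpecimenQuartic.radical_span_X_one_g]
  · change o k ∈ w₁ ⁻¹' (b ⁻¹' {x₀} ∩ closure (b ⁻¹' (T \ {x₀})))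
    rw [hw₁Z₁]
    have h1 : (X 1 : MvPolynomial (Fin 3) k) ∈ (o k).asIdeal := Ideal.subset_span (Set.mem_range_self 1)
    have h2' : (X 2 : MvPolynomial (Fin 3) k) ∈ (o k).asIdeal := Ideal.subset_span (Set.mem_range_self 2)
    have e : (X 2 ^ 2 + X 1 ^ 2 * (1 + X 0 ^ 4) : MvPolynomial (Fin 3) k) = X 2 * X 2 + X 1 * (X 1 * (1 + X 0 ^ 4)) := by ring
    have hg : (X 2 ^ 2 + X 1 ^ 2 * (1 + X 0 ^ 4) : MvPolynomial (Fin 3) k) ∈ (o k).asIdeal := by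
      rw [e]
      exact Ideal.add_mem _ (Ideal.mul_mem_left _ _ h2') (Ideal.mul_mem_left _ _ (Ideal.mul_mem_right _ _ h1))
    exact (PrimeSpectrum.mem_zeroLocus _ _).mpr (Set.insert_subset_iff.mpr ⟨h1, Set.singleton_subset_iff.mpr hg⟩)

end InnerStage

end SpecimenQuarticTcPlus

end Summit.ResolutionOfSingularities.ResolutionOfSingularities.Cruxes.EquisingularLiftNat.Sections
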